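import Mathlib
import Literature.NumberTheory.Irrationality.BrownZudilin2022.GeneralFamily
import Literature.NumberTheory.Irrationality.BrownZudilin2022.CubicalForm
import Literature.NumberTheory.Irrationality.BrownZudilin2022.BarnesRepresentation
import Summits.KontsevichZagierPeriods.Zeta5Search.WedgeDictionaryThreeTerm

/-!
# (H1)-free cellular relations by TRANSPORT, part A: the invariance group at work (cell `pub-zeta5`, lineage gen-1, g21)

HONEST FRAMING: systematic search; no irrationality claim unless certified.  Structure of gen-1's period dictionary
(`WedgeDictionary.explicitPQ`, an OPEN conjecture node) only; nothing about linear forms or ζ(5); nothing is evaluated.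

OUR work (Summit side).  Input, as a HYPOTHESIS: F3 = `invariance_group` (`BarnesRepresentation.lean`: for `σ ∈ Σ₇` and `a`, `σ·a`
both convergent, `I(σ·a)/∏_{i∈F} h_i(σ·a)! = I(a)/∏_{i∈F} h_i(a)!`, Brown–Zudilin arXiv:2210.03391 Sect. 7–8, eq. (27)).
* `prodF a = ∏_{i∈F} h_i(a)!` (as a real number), `prodF_pos`, `normalisedIntegral'_eq`;
* `transport_eq` — F3 cross-multiplied: `I(σ·a)·prodF a = I(a)·prodF (σ·a)`;
* `fact_split` — `z! = z·(z−1)!` for `1 ≤ z : ℤ` through `Int.toNat`;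
* `threeTermRel_swap` and the orientation-reversed forms of the `CellStar` coefficients;
* for the seven slot transpositions `τ ∈ {(23),(24),(67),(56),(25),(46),(26)}` used by the transported cells: `slotPerm τ a` as an explicit
  vector (`slotPerm_swapUV`) and its commutation with the cell difference vectors (`slotPerm_swapUV_slotDown k`, `slotPerm_swapUV_dsUp`:
  `τ·(a + slotDown k) = τ·a + slotDown (τ k)`, `τ·(a + dsUp) = τ·a + dsUp`).
Why transport works uniformly (gen-1 g21, exact check `code/gen1/g21/transport.py`, all 21 transpositions, every instance of base level ≤ 4,
0 mismatches): in the normalisation `Ĩ(b) = I(b)·∏_{j∉{2,3}} b_j!·∏_{non-edges} (N−b_j−b_m)!` (which F3 makes Σ₇-INVARIANT, the 28 forms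
being `b_j` and `N−b_j−b_m`), `CellStar(i,k)` reads `(b_i−b_k)(N+1−b_i−b_k)·Ĩ(b) − b_k·Ĩ(b−e_k) + b_i·Ĩ(b−e_i) = 0` and `CellPencil(i)` reads
`−∏_j(b_j+1)·Ĩ(b) + (b_i+1)(N+2−b_i)·Ĩ(b+𝟙) + (b_i+1)·Ĩ(b+𝟙−e_i) = 0` — manifestly Σ₇-covariant.
-/

set_option maxHeartbeats 8000000
set_option linter.unusedSimpArgs false
set_option linter.unusedTactic false
set_option linter.unreachableTactic false
set_option linter.unnecessarySeqFocus false
set_option linter.style.longLine false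
set_option linter.unusedVariables false

namespace Summit.KontsevichZagierPeriods.Zeta5Search.WedgeDictionary.KernelCells

open Literature.NumberTheory.Irrationality.BrownZudilin2022 MeasureTheory

/-- `∏_{i∈F} h_i(a)!` as a real number (the normalising product of (27)). -/
noncomputable def prodF (a : Fin 8 → ℤ) : ℝ := (Fset.map fun i => ((hForm a i).toNat.factorial : ℝ)).prod

/-- `normalisedIntegral' a = I(a)/prodF a` (definitional). -/
theorem normalisedIntegral'_eq (a : Fin 8 → ℤ) : normalisedIntegral' a = cellularIntegral a / prodF a := rfl

/-- The normalising product is positive. -/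
theorem prodF_pos (a : Fin 8 → ℤ) : 0 < prodF a := by
  unfold prodF; simp only [Fset, List.map, List.prod_cons, List.prod_nil]; positivity

/-- `prodF` unfolded: the seventeen factorials `h_i(a)!`, `i ∈ F` in the printed order, with `hForm a i` kept folded. -/
theorem prodF_unfold (a : Fin 8 → ℤ) : prodF a =
    ((hForm a 1).toNat.factorial : ℝ) * (((hForm a 2).toNat.factorial : ℝ) * (((hForm a 3).toNat.factorial : ℝ) *
    (((hForm a 4).toNat.factorial : ℝ) * (((hForm a 5).toNat.factorial : ℝ) * (((hForm a 6).toNat.factorial : ℝ) *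
    (((hForm a 7).toNat.factorial : ℝ) * (((hForm a 10).toNat.factorial : ℝ) * (((hForm a 14).toNat.factorial : ℝ) *
    (((hForm a 28).toNat.factorial : ℝ) * (((hForm a 20).toNat.factorial : ℝ) * (((hForm a 18).toNat.factorial : ℝ) *
    (((hForm a 23).toNat.factorial : ℝ) * (((hForm a 11).toNat.factorial : ℝ) * (((hForm a 9).toNat.factorial : ℝ) *
    (((hForm a 16).toNat.factorial : ℝ) * (((hForm a 27).toNat.factorial : ℝ) * 1)))))))))))))))) := by
  unfold prodF; simp only [Fset, List.map, List.prod_cons, List.prod_nil]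

/-- F3 cross-multiplied: `I(σ·a)·prodF a = I(a)·prodF (σ·a)` for `a`, `σ·a` convergent. -/
theorem transport_eq (hF3 : invariance_group) (σ : Equiv.Perm (Fin 7)) (a : Fin 8 → ℤ) (ha : Converges a)
    (hσ : Converges (slotPerm σ a)) : cellularIntegral (slotPerm σ a) * prodF a = cellularIntegral a * prodF (slotPerm σ a) := by
  have h := hF3 σ a ha hσ
  rw [normalisedIntegral'_eq, normalisedIntegral'_eq, div_eq_div_iff (ne_of_gt (prodF_pos _)) (ne_of_gt (prodF_pos _))] at h
  exact h

/-- `z! = z·(z−1)!` for an integer `z ≥ 1`, through `Int.toNat`, as real numbers. -/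
theorem fact_split (z : ℤ) (h : 1 ≤ z) : ((z.toNat.factorial : ℕ) : ℝ) = (z : ℝ) * (((z - 1).toNat.factorial : ℕ) : ℝ) := by
  have h1 : z.toNat = (z - 1).toNat + 1 := by omega
  have h2 : (((z - 1).toNat : ℕ) : ℝ) = (z : ℝ) - 1 := by exact_mod_cast (show (((z - 1).toNat : ℕ) : ℤ) = z - 1 by omega)
  rw [h1, Nat.factorial_succ]; push_cast; rw [h2]; ring

/-- Convergence gives `0 ≤ h_i(a)` for each `i ∈ F`. -/
theorem hForm_nonneg {a : Fin 8 → ℤ} (h : Converges a) (i : ℕ) (hi : i ∈ Fset) : 0 ≤ hForm a i :=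
  (converges_iff_hForm a).1 h i hi

/-- Orientation swap of a three-term relation. -/
theorem threeTermRel_swap {α β γ : ℚ} {x y z : Fin 8 → ℤ} (h : ThreeTermRel α β γ x y z) : ThreeTermRel (-α) (-γ) (-β) x z y := by
  unfold ThreeTermRel at h ⊢; push_cast; linarith

/-- `starKappa` is antisymmetric in the two slots. -/
theorem starKappa_swap (P : ℕ → ℤ) (i k : ℕ) : starKappa P k i = -starKappa P i k := by unfold starKappa; ring

/-- `CellStar` at `(k,i)` from `CellStar` at `(i,k)` (same three members, orientation reversed). -/
theorem cellStar_swap {a : Fin 8 → ℤ} {i k : ℕ}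
    (h : ThreeTermRel (starKappa (bOfA a) i k) (-fanCoeff (bOfA a) k) (fanCoeff (bOfA a) i) a (a + slotDown k) (a + slotDown i)) :
    ThreeTermRel (starKappa (bOfA a) k i) (-fanCoeff (bOfA a) i) (fanCoeff (bOfA a) k) a (a + slotDown i) (a + slotDown k) := by
  have h' := threeTermRel_swap h
  rw [starKappa_swap]; simpa using h'

/-- The slot transposition `τ = (23)` on the exponents `a` (through `b ↦ σ·b`, `aOfB`), explicitly. -/
theorem slotPerm_swap23 (a : Fin 8 → ℤ) : slotPerm (Equiv.swap (1 : Fin 7) (2 : Fin 7)) a = ![a 0 + a 1 - a 3, a 3, a 2, a 1, -a 1 + a 3 + a 4, a 5, a 6, -a 1 + a 3 + a 7] := by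
  ext i; fin_cases i <;> simp [slotPerm, aOfB, bOfA, Equiv.swap_apply_def] <;> ring

/-- `τ = (23)` carries the difference vector `slotDown 1` to `slotDown 1`. -/
theorem slotPerm_swap23_slotDown1 (a : Fin 8 → ℤ) :
    slotPerm (Equiv.swap (1 : Fin 7) (2 : Fin 7)) (a + slotDown 1) = slotPerm (Equiv.swap (1 : Fin 7) (2 : Fin 7)) a + slotDown 1 := by
  rw [slotPerm_swap23, slotPerm_swap23]
  ext i; fin_cases i <;> simp [slotDown, dsUp] <;> ring

/-- `τ = (23)` carries the difference vector `slotDown 2` to `slotDown 3`. -/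
theorem slotPerm_swap23_slotDown2 (a : Fin 8 → ℤ) :
    slotPerm (Equiv.swap (1 : Fin 7) (2 : Fin 7)) (a + slotDown 2) = slotPerm (Equiv.swap (1 : Fin 7) (2 : Fin 7)) a + slotDown 3 := by
  rw [slotPerm_swap23, slotPerm_swap23]
  ext i; fin_cases i <;> simp [slotDown, dsUp] <;> ring

/-- `τ = (23)` carries the difference vector `slotDown 3` to `slotDown 2`. -/
theorem slotPerm_swap23_slotDown3 (a : Fin 8 → ℤ) :
    slotPerm (Equiv.swap (1 : Fin 7) (2 : Fin 7)) (a + slotDown 3) = slotPerm (Equiv.swap (1 : Fin 7) (2 : Fin 7)) a + slotDown 2 := by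
  rw [slotPerm_swap23, slotPerm_swap23]
  ext i; fin_cases i <;> simp [slotDown, dsUp] <;> ring

/-- `τ = (23)` carries the difference vector `slotDown 4` to `slotDown 4`. -/
theorem slotPerm_swap23_slotDown4 (a : Fin 8 → ℤ) :
    slotPerm (Equiv.swap (1 : Fin 7) (2 : Fin 7)) (a + slotDown 4) = slotPerm (Equiv.swap (1 : Fin 7) (2 : Fin 7)) a + slotDown 4 := by
  rw [slotPerm_swap23, slotPerm_swap23]
  ext i; fin_cases i <;> simp [slotDown, dsUp] <;> ring

/-- `τ = (23)` carries the difference vector `slotDown 7` to `slotDown 7`. -/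
theorem slotPerm_swap23_slotDown7 (a : Fin 8 → ℤ) :
    slotPerm (Equiv.swap (1 : Fin 7) (2 : Fin 7)) (a + slotDown 7) = slotPerm (Equiv.swap (1 : Fin 7) (2 : Fin 7)) a + slotDown 7 := by
  rw [slotPerm_swap23, slotPerm_swap23]
  ext i; fin_cases i <;> simp [slotDown, dsUp] <;> ring

/-- The slot transposition `τ = (24)` on the exponents `a` (through `b ↦ σ·b`, `aOfB`), explicitly. -/
theorem slotPerm_swap24 (a : Fin 8 → ℤ) : slotPerm (Equiv.swap (1 : Fin 7) (3 : Fin 7)) a = ![a 0 - a 2 + a 4, a 1 + a 2 - a 4, a 4, a 3, a 2, a 5, a 6, a 7] := by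
  ext i; fin_cases i <;> simp [slotPerm, aOfB, bOfA, Equiv.swap_apply_def] <;> ring

/-- `τ = (24)` carries the difference vector `slotDown 1` to `slotDown 1`. -/
theorem slotPerm_swap24_slotDown1 (a : Fin 8 → ℤ) :
    slotPerm (Equiv.swap (1 : Fin 7) (3 : Fin 7)) (a + slotDown 1) = slotPerm (Equiv.swap (1 : Fin 7) (3 : Fin 7)) a + slotDown 1 := by
  rw [slotPerm_swap24, slotPerm_swap24]
  ext i; fin_cases i <;> simp [slotDown, dsUp] <;> ring

/-- `τ = (24)` carries the difference vector `slotDown 2` to `slotDown 4`. -/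
theorem slotPerm_swap24_slotDown2 (a : Fin 8 → ℤ) :
    slotPerm (Equiv.swap (1 : Fin 7) (3 : Fin 7)) (a + slotDown 2) = slotPerm (Equiv.swap (1 : Fin 7) (3 : Fin 7)) a + slotDown 4 := by
  rw [slotPerm_swap24, slotPerm_swap24]
  ext i; fin_cases i <;> simp [slotDown, dsUp] <;> ring

/-- `τ = (24)` carries the difference vector `slotDown 3` to `slotDown 3`. -/
theorem slotPerm_swap24_slotDown3 (a : Fin 8 → ℤ) :
    slotPerm (Equiv.swap (1 : Fin 7) (3 : Fin 7)) (a + slotDown 3) = slotPerm (Equiv.swap (1 : Fin 7) (3 : Fin 7)) a + slotDown 3 := by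
  rw [slotPerm_swap24, slotPerm_swap24]
  ext i; fin_cases i <;> simp [slotDown, dsUp] <;> ring

/-- `τ = (24)` carries the difference vector `slotDown 4` to `slotDown 2`. -/
theorem slotPerm_swap24_slotDown4 (a : Fin 8 → ℤ) :
    slotPerm (Equiv.swap (1 : Fin 7) (3 : Fin 7)) (a + slotDown 4) = slotPerm (Equiv.swap (1 : Fin 7) (3 : Fin 7)) a + slotDown 2 := by
  rw [slotPerm_swap24, slotPerm_swap24]
  ext i; fin_cases i <;> simp [slotDown, dsUp] <;> ring

/-- `τ = (24)` carries the difference vector `slotDown 5` to `slotDown 5`. -/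
theorem slotPerm_swap24_slotDown5 (a : Fin 8 → ℤ) :
    slotPerm (Equiv.swap (1 : Fin 7) (3 : Fin 7)) (a + slotDown 5) = slotPerm (Equiv.swap (1 : Fin 7) (3 : Fin 7)) a + slotDown 5 := by
  rw [slotPerm_swap24, slotPerm_swap24]
  ext i; fin_cases i <;> simp [slotDown, dsUp] <;> ring

/-- `τ = (24)` carries the difference vector `slotDown 7` to `slotDown 7`. -/
theorem slotPerm_swap24_slotDown7 (a : Fin 8 → ℤ) :
    slotPerm (Equiv.swap (1 : Fin 7) (3 : Fin 7)) (a + slotDown 7) = slotPerm (Equiv.swap (1 : Fin 7) (3 : Fin 7)) a + slotDown 7 := by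
  rw [slotPerm_swap24, slotPerm_swap24]
  ext i; fin_cases i <;> simp [slotDown, dsUp] <;> ring

/-- The slot transposition `τ = (67)` on the exponents `a` (through `b ↦ σ·b`, `aOfB`), explicitly. -/
theorem slotPerm_swap67 (a : Fin 8 → ℤ) : slotPerm (Equiv.swap (5 : Fin 7) (6 : Fin 7)) a = ![a 0, a 1, a 2, a 3, a 4, -a 1 - a 2 + a 3 - a 5 + a 6 + 2 * a 7, a 6, a 7] := by
  ext i; fin_cases i <;> simp [slotPerm, aOfB, bOfA, Equiv.swap_apply_def] <;> ring

/-- `τ = (67)` carries the difference vector `slotDown 1` to `slotDown 1`. -/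
theorem slotPerm_swap67_slotDown1 (a : Fin 8 → ℤ) :
    slotPerm (Equiv.swap (5 : Fin 7) (6 : Fin 7)) (a + slotDown 1) = slotPerm (Equiv.swap (5 : Fin 7) (6 : Fin 7)) a + slotDown 1 := by
  rw [slotPerm_swap67, slotPerm_swap67]
  ext i; fin_cases i <;> simp [slotDown, dsUp] <;> ring

/-- `τ = (67)` carries the difference vector `slotDown 2` to `slotDown 2`. -/
theorem slotPerm_swap67_slotDown2 (a : Fin 8 → ℤ) :
    slotPerm (Equiv.swap (5 : Fin 7) (6 : Fin 7)) (a + slotDown 2) = slotPerm (Equiv.swap (5 : Fin 7) (6 : Fin 7)) a + slotDown 2 := by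
  rw [slotPerm_swap67, slotPerm_swap67]
  ext i; fin_cases i <;> simp [slotDown, dsUp] <;> ring

/-- `τ = (67)` carries the difference vector `slotDown 6` to `slotDown 7`. -/
theorem slotPerm_swap67_slotDown6 (a : Fin 8 → ℤ) :
    slotPerm (Equiv.swap (5 : Fin 7) (6 : Fin 7)) (a + slotDown 6) = slotPerm (Equiv.swap (5 : Fin 7) (6 : Fin 7)) a + slotDown 7 := by
  rw [slotPerm_swap67, slotPerm_swap67]
  ext i; fin_cases i <;> simp [slotDown, dsUp] <;> ring

/-- `τ = (67)` carries the difference vector `dsUp` to `dsUp`. -/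
theorem slotPerm_swap67_dsUp (a : Fin 8 → ℤ) :
    slotPerm (Equiv.swap (5 : Fin 7) (6 : Fin 7)) (a + dsUp) = slotPerm (Equiv.swap (5 : Fin 7) (6 : Fin 7)) a + dsUp := by
  rw [slotPerm_swap67, slotPerm_swap67]
  ext i; fin_cases i <;> simp [slotDown, dsUp] <;> ring

/-- The slot transposition `τ = (56)` on the exponents `a` (through `b ↦ σ·b`, `aOfB`), explicitly. -/
theorem slotPerm_swap56 (a : Fin 8 → ℤ) : slotPerm (Equiv.swap (4 : Fin 7) (5 : Fin 7)) a = ![a 0, a 1, a 2, a 3, a 4, a 5, -a 1 - a 2 + a 3 - a 5 + a 6 + 2 * a 7, a 1 + a 2 - a 3 + a 5 - a 7] := by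
  ext i; fin_cases i <;> simp [slotPerm, aOfB, bOfA, Equiv.swap_apply_def] <;> ring

/-- `τ = (56)` carries the difference vector `slotDown 3` to `slotDown 3`. -/
theorem slotPerm_swap56_slotDown3 (a : Fin 8 → ℤ) :
    slotPerm (Equiv.swap (4 : Fin 7) (5 : Fin 7)) (a + slotDown 3) = slotPerm (Equiv.swap (4 : Fin 7) (5 : Fin 7)) a + slotDown 3 := by
  rw [slotPerm_swap56, slotPerm_swap56]
  ext i; fin_cases i <;> simp [slotDown, dsUp] <;> ring

/-- `τ = (56)` carries the difference vector `slotDown 4` to `slotDown 4`. -/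
theorem slotPerm_swap56_slotDown4 (a : Fin 8 → ℤ) :
    slotPerm (Equiv.swap (4 : Fin 7) (5 : Fin 7)) (a + slotDown 4) = slotPerm (Equiv.swap (4 : Fin 7) (5 : Fin 7)) a + slotDown 4 := by
  rw [slotPerm_swap56, slotPerm_swap56]
  ext i; fin_cases i <;> simp [slotDown, dsUp] <;> ring

/-- `τ = (56)` carries the difference vector `slotDown 6` to `slotDown 5`. -/
theorem slotPerm_swap56_slotDown6 (a : Fin 8 → ℤ) :
    slotPerm (Equiv.swap (4 : Fin 7) (5 : Fin 7)) (a + slotDown 6) = slotPerm (Equiv.swap (4 : Fin 7) (5 : Fin 7)) a + slotDown 5 := by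
  rw [slotPerm_swap56, slotPerm_swap56]
  ext i; fin_cases i <;> simp [slotDown, dsUp] <;> ring

/-- The slot transposition `τ = (25)` on the exponents `a` (through `b ↦ σ·b`, `aOfB`), explicitly. -/
theorem slotPerm_swap25 (a : Fin 8 → ℤ) : slotPerm (Equiv.swap (1 : Fin 7) (4 : Fin 7)) a = ![a 0 - a 2 + a 7, a 1 + a 2 - a 7, a 7, a 3, a 4, a 2 + a 5 - a 7, a 6, a 2] := by
  ext i; fin_cases i <;> simp [slotPerm, aOfB, bOfA, Equiv.swap_apply_def] <;> ring

/-- `τ = (25)` carries the difference vector `slotDown 1` to `slotDown 1`. -/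
theorem slotPerm_swap25_slotDown1 (a : Fin 8 → ℤ) :
    slotPerm (Equiv.swap (1 : Fin 7) (4 : Fin 7)) (a + slotDown 1) = slotPerm (Equiv.swap (1 : Fin 7) (4 : Fin 7)) a + slotDown 1 := by
  rw [slotPerm_swap25, slotPerm_swap25]
  ext i; fin_cases i <;> simp [slotDown, dsUp] <;> ring

/-- `τ = (25)` carries the difference vector `slotDown 5` to `slotDown 2`. -/
theorem slotPerm_swap25_slotDown5 (a : Fin 8 → ℤ) :
    slotPerm (Equiv.swap (1 : Fin 7) (4 : Fin 7)) (a + slotDown 5) = slotPerm (Equiv.swap (1 : Fin 7) (4 : Fin 7)) a + slotDown 2 := by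
  rw [slotPerm_swap25, slotPerm_swap25]
  ext i; fin_cases i <;> simp [slotDown, dsUp] <;> ring

/-- `τ = (25)` carries the difference vector `slotDown 7` to `slotDown 7`. -/
theorem slotPerm_swap25_slotDown7 (a : Fin 8 → ℤ) :
    slotPerm (Equiv.swap (1 : Fin 7) (4 : Fin 7)) (a + slotDown 7) = slotPerm (Equiv.swap (1 : Fin 7) (4 : Fin 7)) a + slotDown 7 := by
  rw [slotPerm_swap25, slotPerm_swap25]
  ext i; fin_cases i <;> simp [slotDown, dsUp] <;> ring

/-- The slot transposition `τ = (46)` on the exponents `a` (through `b ↦ σ·b`, `aOfB`), explicitly. -/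
theorem slotPerm_swap46 (a : Fin 8 → ℤ) : slotPerm (Equiv.swap (3 : Fin 7) (5 : Fin 7)) a = ![a 0, a 1, a 2, a 3, a 1 + a 2 - a 3 + a 5 - a 7, -a 1 - a 2 + a 3 + a 4 + a 7, -a 1 - a 2 + a 3 + a 4 - a 5 + a 6 + a 7, a 7] := by
  ext i; fin_cases i <;> simp [slotPerm, aOfB, bOfA, Equiv.swap_apply_def] <;> ring

/-- `τ = (46)` carries the difference vector `slotDown 5` to `slotDown 5`. -/
theorem slotPerm_swap46_slotDown5 (a : Fin 8 → ℤ) :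
    slotPerm (Equiv.swap (3 : Fin 7) (5 : Fin 7)) (a + slotDown 5) = slotPerm (Equiv.swap (3 : Fin 7) (5 : Fin 7)) a + slotDown 5 := by
  rw [slotPerm_swap46, slotPerm_swap46]
  ext i; fin_cases i <;> simp [slotDown, dsUp] <;> ring

/-- `τ = (46)` carries the difference vector `slotDown 6` to `slotDown 4`. -/
theorem slotPerm_swap46_slotDown6 (a : Fin 8 → ℤ) :
    slotPerm (Equiv.swap (3 : Fin 7) (5 : Fin 7)) (a + slotDown 6) = slotPerm (Equiv.swap (3 : Fin 7) (5 : Fin 7)) a + slotDown 4 := by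
  rw [slotPerm_swap46, slotPerm_swap46]
  ext i; fin_cases i <;> simp [slotDown, dsUp] <;> ring

/-- The slot transposition `τ = (26)` on the exponents `a` (through `b ↦ σ·b`, `aOfB`), explicitly. -/
theorem slotPerm_swap26 (a : Fin 8 → ℤ) : slotPerm (Equiv.swap (1 : Fin 7) (5 : Fin 7)) a = ![a 0 + a 1 - a 3 + a 5 - a 7, a 3 - a 5 + a 7, a 1 + a 2 - a 3 + a 5 - a 7, a 3, a 4, -a 1 + a 3 + a 7, -a 1 + a 3 - a 5 + a 6 + a 7, a 7] := by
  ext i; fin_cases i <;> simp [slotPerm, aOfB, bOfA, Equiv.swap_apply_def] <;> ring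

/-- `τ = (26)` carries the difference vector `slotDown 6` to `slotDown 2`. -/
theorem slotPerm_swap26_slotDown6 (a : Fin 8 → ℤ) :
    slotPerm (Equiv.swap (1 : Fin 7) (5 : Fin 7)) (a + slotDown 6) = slotPerm (Equiv.swap (1 : Fin 7) (5 : Fin 7)) a + slotDown 2 := by
  rw [slotPerm_swap26, slotPerm_swap26]
  ext i; fin_cases i <;> simp [slotDown, dsUp] <;> ring

/-- `τ = (26)` carries the difference vector `slotDown 7` to `slotDown 7`. -/
theorem slotPerm_swap26_slotDown7 (a : Fin 8 → ℤ) :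
    slotPerm (Equiv.swap (1 : Fin 7) (5 : Fin 7)) (a + slotDown 7) = slotPerm (Equiv.swap (1 : Fin 7) (5 : Fin 7)) a + slotDown 7 := by
  rw [slotPerm_swap26, slotPerm_swap26]
  ext i; fin_cases i <;> simp [slotDown, dsUp] <;> ring

end Summit.KontsevichZagierPeriods.Zeta5Search.WedgeDictionary.KernelCells
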